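import Summits.AtomisticToContinuum.Crystallization.Theorems.OverbindingBudgetAffineFarStraighteningFrame
import Summits.AtomisticToContinuum.Crystallization.Theorems.OverbindingBudgetAffineFarDevelopmentPattern

/-!
# Overbinding budget, affine far field — DEVELOPMENT, snap transport (lens-4 g59, brick D-C core)

The cocycle-free curvature step of the radial development (memo NODE-g59-DevSpec §3 L5), as pure algebra over abstract data.
Three mutually adjacent sites `c, p, n` carry pattern frames; between adjacent frames the development has EXACT SNAPS with READING
AGREEMENT (`label_j q = e_jm + U_jm (label_m q)` for every site `q` read by both).  If `(c,p)` and `(p,n)` have exact snaps `U_cp`, `U_pn`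
with reading agreement, and `W` is the pair snap of `(c,n)` (reading agreement for `W`), then the composite `V = U_cp ∘ U_pn` EQUALS `W`:
both agree on `f_nc = label_n c`, on `f_np = label_n p`, and on the label of a tripod site (`exists_tripod_of_twoShell`), and linear maps are
determined by a tripod.  Consequently `R_c⁻¹ R_n` is the pair snap of `(c,n)` whenever `R_c⁻¹ R_p` and `R_p⁻¹ R_n` are the pair snaps —
the invariant (S⁺) propagates around the cap star without any cocycle enumeration.
-/

namespace Summit.AtomisticToContinuum.Crystallization.Theorems.OverbindingBudgetAffineFarSmoothSplit

open Literature.Geometry.DiscreteGeometry (fccTwoShellPattern hcpTwoShellPattern fccInt hcpInt sqNormInt sqNormInt_fccInt sqNormInt_hcpInt)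
open scoped RealInnerProductSpace

/-- Composite reading: if `(c,p)` and `(p,n)` read a site consistently (`g_p = e_pn + U_pn g`, `g_c = e_cp + U_cp g_p`) and `n` itself is read
consistently by `(c,p)` (`e_cn = e_cp + U_cp e_pn`), then `g_c = e_cn + U_cp (U_pn g)`. [this file] -/
theorem reading_comp {E : Type*} [NormedAddCommGroup E] [InnerProductSpace ℝ E] (Ucp Upn : E →ₗᵢ[ℝ] E)
    {e_cp e_cn e_pn g g_p g_c : E} (h1 : e_cn = e_cp + Ucp e_pn) (hp : g_p = e_pn + Upn g) (hc : g_c = e_cp + Ucp g_p) :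
    g_c = e_cn + Ucp (Upn g) := by
  rw [hc, hp, map_add, h1, add_assoc]

/-- **SNAP TRANSPORT.**  `Pn` a two-shell pattern (the pattern at `n`); `Ucp`, `Upn` the exact snaps of `(c,p)`, `(p,n)` and `W` the pair snap
of `(c,n)`, with: (h1) `(c,p)` reads `n`: `e_cn = e_cp + Ucp e_pn`; (h2) `(c,p)` reads `c`: `Ucp e_pc = −e_cp`; (h3) `(p,n)` reads `c`:
`e_pc = e_pn + Upn f_nc`; (h4) `(p,n)` reads `p`: `Upn f_np = −e_pn`; (h5), (h6) `W` reads `c` and `p`: `W f_nc = −e_cn`, `e_cp = e_cn + W f_np`;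
(htri) every unit `g ∈ Pn` within two shells of `f_nc` and `f_np` is the label of a site read consistently by all three pairs.  Then
`Ucp ∘ Upn = W`. [this file] -/
theorem snap_transport {Pn : Finset (EuclideanSpace ℝ (Fin 3))} (hPn : Pn = fccTwoShellPattern ∨ Pn = hcpTwoShellPattern)
    (Ucp Upn W : EuclideanSpace ℝ (Fin 3) →ₗᵢ[ℝ] EuclideanSpace ℝ (Fin 3))
    {e_cp e_cn e_pc e_pn f_nc f_np : EuclideanSpace ℝ (Fin 3)}
    (h1 : e_cn = e_cp + Ucp e_pn) (h2 : Ucp e_pc = -e_cp) (h3 : e_pc = e_pn + Upn f_nc) (h4 : Upn f_np = -e_pn)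
    (h5 : W f_nc = -e_cn) (h6 : e_cp = e_cn + W f_np)
    (hfnc : f_nc ∈ Pn) (hfnc1 : ‖f_nc‖ = 1) (hfnp : f_np ∈ Pn) (hfnp1 : ‖f_np‖ = 1) (hadj : dist f_nc f_np = 1)
    (htri : ∀ g ∈ Pn, ‖g‖ = 1 → (dist g f_nc = 1 ∨ dist g f_nc = Real.sqrt 2) → (dist g f_np = 1 ∨ dist g f_np = Real.sqrt 2) →
      ∃ g_p g_c : EuclideanSpace ℝ (Fin 3), g_p = e_pn + Upn g ∧ g_c = e_cp + Ucp g_p ∧ g_c = e_cn + W g) :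
    ∀ v, Ucp (Upn v) = W v := by
  obtain ⟨g, hg, hg1, hd1, hd2, hext⟩ := exists_tripod_of_twoShell hPn hfnc hfnc1 hfnp hfnp1 hadj
  obtain ⟨g_p, g_c, hp, hc, hW⟩ := htri g hg hg1 hd1 hd2
  -- the three agreements
  have a1 : Ucp (Upn f_nc) = W f_nc := by
    have : Upn f_nc = e_pc - e_pn := by rw [h3]; abel
    rw [this, map_sub, h2, h5, h1]; abel
  have a2 : Ucp (Upn f_np) = W f_np := by
    have hW' : W f_np = e_cp - e_cn := by rw [h6]; abel
    rw [h4, map_neg, hW', h1]; abel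
  have a3 : Ucp (Upn g) = W g := by
    have hcomp := reading_comp Ucp Upn h1 hp hc
    have : e_cn + Ucp (Upn g) = e_cn + W g := by rw [← hcomp, ← hW]
    exact add_left_cancel this
  have key := hext (Ucp.toLinearMap.comp Upn.toLinearMap) W.toLinearMap (by simpa using a1) (by simpa using a2) (by simpa using a3)
  intro v
  have := congrArg (fun L : EuclideanSpace ℝ (Fin 3) →ₗ[ℝ] EuclideanSpace ℝ (Fin 3) => L v) key
  simpa using this

/-- **TRANSPORT for frames**: with pattern frames `R_c, R_p, R_n` (linear isometries into the development coordinates) such that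
`R_p = R_c ∘ Ucp` and `R_n = R_p ∘ Upn` (the invariant (S⁺) for `(c,p)` and `(p,n)`), the conclusion of `snap_transport` reads
`R_n = R_c ∘ W`, i.e. (S⁺) for `(c,n)`. [this file] -/
theorem frame_transport (R_c R_p R_n Ucp Upn W : EuclideanSpace ℝ (Fin 3) →ₗᵢ[ℝ] EuclideanSpace ℝ (Fin 3))
    (hcp : ∀ v, R_p v = R_c (Ucp v)) (hpn : ∀ v, R_n v = R_p (Upn v)) (hW : ∀ v, Ucp (Upn v) = W v) :
    ∀ v, R_n v = R_c (W v) := by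
  intro v
  rw [hpn, hcp, hW]

/-- Reading agreement is symmetric: if `U f = −e` and `U'` inverts `U`, then `u = e + U u'` iff `u' = f + U' u`. [this file] -/
theorem reading_symm {E : Type*} [NormedAddCommGroup E] [InnerProductSpace ℝ E] (U U' : E →ₗᵢ[ℝ] E)
    (hinv : ∀ v, U' (U v) = v) (hinv' : ∀ v, U (U' v) = v) {e f : E} (hf : U f = -e) {u u' : E} :
    u = e + U u' ↔ u' = f + U' u := by
  have hU'e : U' e = -f := by
    have h := hinv f
    rw [hf, map_neg, neg_eq_iff_eq_neg] at h
    exact h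
  constructor
  · intro h
    rw [h, map_add, hinv, hU'e]; abel
  · intro h
    rw [h, map_add, hinv', hf]; abel

/-! ## §3  Closing the cocycle by CLOSENESS (no third physical site)

The hypothesis `htri` of `snap_transport` asks for a third site read by all three pairs; for an HCP basal down-triangle the tripod label
sits in a SECOND shell and, under a `4.9 %` affine distortion, that site can fall outside the `(3/2)`-labelling window of the far vertex.
The variant below replaces the third site by CLOSENESS: the two isometries `Ucp ∘ Upn` and `W` are `O(ε)`-close (three transfer estimates of
`pair_snap`), they agree on the adjacent unit pair `f_nc, f_np`, and two linear isometries of `ℝ³` agreeing on an independent pair differ by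
the identity or by the reflection in that plane — the reflection is `2`-far on the normal.  (Gram identity + Cramer, no orthogonal complements.)
-/

-- `inner_coord3` (inner product in coordinates) restates the tree's `…Theorems.inner_fin3'` (gate dedup.landed at landing,
-- hand-2 g27): copy deleted, inlined as a local `have` in `det3R_sq_eq_gram` below; statements untouched.

/-- GRAM IDENTITY `det(a,b,c)² = det (Gram matrix)`. [folklore] -/
theorem det3R_sq_eq_gram (a b c : EuclideanSpace ℝ (Fin 3)) :
    det3R a b c ^ 2 = ⟪a, a⟫ * (⟪b, b⟫ * ⟪c, c⟫ - ⟪b, c⟫ ^ 2) - ⟪a, b⟫ * (⟪a, b⟫ * ⟪c, c⟫ - ⟪b, c⟫ * ⟪a, c⟫) +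
      ⟪a, c⟫ * (⟪a, b⟫ * ⟪b, c⟫ - ⟪b, b⟫ * ⟪a, c⟫) := by
  have inner_coord3 : ∀ x y : EuclideanSpace ℝ (Fin 3), ⟪x, y⟫ = x 0 * y 0 + x 1 * y 1 + x 2 * y 2 := fun x y => by
    simp [EuclideanSpace.inner_eq_star_dotProduct, dotProduct, Fin.sum_univ_three]
    try ring
  simp only [inner_coord3, det3R]
  ring

/-- Column operation: `det(a, b, c − s a − t b) = det(a, b, c)`. [folklore] -/
theorem det3R_sub_smul_sub_smul (a b c : EuclideanSpace ℝ (Fin 3)) (s t : ℝ) : det3R a b (c - s • a - t • b) = det3R a b c := by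
  simp only [det3R, PiLp.sub_apply, PiLp.smul_apply, smul_eq_mul]
  ring

/-- `det(a, b, 0) = 0`. [folklore] -/
theorem det3R_zero_right (a b : EuclideanSpace ℝ (Fin 3)) : det3R a b 0 = 0 := by
  simp [det3R]

/-- **RIGIDITY BY CLOSENESS.**  Two linear isometries of `ℝ³` that agree on unit vectors `f₁, f₂` with `⟪f₁, f₂⟫ = 1/2` and are everywhere
`1`-close (`‖V v − W v‖ ≤ ‖v‖`) are equal.  (`g` is any vector completing `f₁, f₂` to a frame; it only witnesses dimension three.) [this file] -/
theorem linearIsometry_eq_of_pair_of_close (V W : EuclideanSpace ℝ (Fin 3) →ₗᵢ[ℝ] EuclideanSpace ℝ (Fin 3))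
    {f₁ f₂ g : EuclideanSpace ℝ (Fin 3)} (h₁ : ‖f₁‖ = 1) (h₂ : ‖f₂‖ = 1) (h12 : ⟪f₁, f₂⟫ = 1 / 2) (hdet : det3R f₁ f₂ g ≠ 0)
    (hV1 : V f₁ = W f₁) (hV2 : V f₂ = W f₂) (hclose : ∀ v, ‖V v - W v‖ ≤ ‖v‖) : ∀ v, V v = W v := by
  -- a normal vector `ν` of the plane `f₁, f₂`
  set α : ℝ := (4 * ⟪g, f₁⟫ - 2 * ⟪g, f₂⟫) / 3 with hα
  set β : ℝ := (4 * ⟪g, f₂⟫ - 2 * ⟪g, f₁⟫) / 3 with hβ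
  set ν : EuclideanSpace ℝ (Fin 3) := g - α • f₁ - β • f₂ with hν
  have h11 : ⟪f₁, f₁⟫ = 1 := by rw [real_inner_self_eq_norm_sq, h₁]; norm_num
  have h22 : ⟪f₂, f₂⟫ = 1 := by rw [real_inner_self_eq_norm_sq, h₂]; norm_num
  have h21 : ⟪f₂, f₁⟫ = 1 / 2 := by rw [real_inner_comm]; exact h12
  have hν1 : ⟪ν, f₁⟫ = 0 := by
    simp only [hν, inner_sub_left, real_inner_smul_left, h11, h21, hα, hβ]; ring
  have hν2 : ⟪ν, f₂⟫ = 0 := by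
    simp only [hν, inner_sub_left, real_inner_smul_left, h22, h12, hα, hβ]; ring
  have hdetν : det3R f₁ f₂ ν ≠ 0 := by rw [hν, det3R_sub_smul_sub_smul]; exact hdet
  have hν0 : ν ≠ 0 := fun h => hdetν (by rw [h, det3R_zero_right])
  have hνpos : 0 < ‖ν‖ := norm_pos_iff.mpr hν0
  -- the images
  set x := V ν with hx
  set y := W ν with hy
  have hg1 : ‖V f₁‖ = 1 := by rw [LinearIsometry.norm_map, h₁]
  have hg11 : ⟪V f₁, V f₁⟫ = 1 := by rw [real_inner_self_eq_norm_sq, hg1]; norm_num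
  have hg22 : ⟪V f₂, V f₂⟫ = 1 := by rw [LinearIsometry.inner_map_map, h22]
  have hg12 : ⟪V f₁, V f₂⟫ = 1 / 2 := by rw [LinearIsometry.inner_map_map, h12]
  have hg21 : ⟪V f₂, V f₁⟫ = 1 / 2 := by rw [LinearIsometry.inner_map_map, h21]
  have hx1 : ⟪x, V f₁⟫ = 0 := by rw [hx, LinearIsometry.inner_map_map, hν1]
  have hx2 : ⟪x, V f₂⟫ = 0 := by rw [hx, LinearIsometry.inner_map_map, hν2]
  have hy1 : ⟪y, V f₁⟫ = 0 := by rw [hy, hV1, LinearIsometry.inner_map_map, hν1]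
  have hy2 : ⟪y, V f₂⟫ = 0 := by rw [hy, hV2, LinearIsometry.inner_map_map, hν2]
  have hxn : ‖x‖ = ‖ν‖ := by rw [hx, LinearIsometry.norm_map]
  have hyn : ‖y‖ = ‖ν‖ := by rw [hy, LinearIsometry.norm_map]
  have hxx : ⟪x, x⟫ = ‖ν‖ ^ 2 := by rw [real_inner_self_eq_norm_sq, hxn]
  -- the frame `(V f₁, V f₂, x)` is non-degenerate (Gram)
  have hx1' : ⟪V f₁, x⟫ = 0 := by rw [real_inner_comm]; exact hx1
  have hx2' : ⟪V f₂, x⟫ = 0 := by rw [real_inner_comm]; exact hx2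
  have hD : det3R (V f₁) (V f₂) x ≠ 0 := by
    intro h0
    have hg := det3R_sq_eq_gram (V f₁) (V f₂) x
    rw [h0, hg11, hg22, hg12, hx1', hx2', hxx] at hg
    nlinarith
  -- Cramer: `y` is a multiple of `x`
  have hcr := cramer3 (V f₁) (V f₂) x y
  have e1 := congrArg (fun z => ⟪z, V f₁⟫) hcr
  have e2 := congrArg (fun z => ⟪z, V f₂⟫) hcr
  simp only [inner_add_left, real_inner_smul_left, hg11, hg21, hx1, hy1, hg12, hg22, hx2, hy2] at e1 e2
  have c1 : det3R y (V f₂) x = 0 := by linarith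
  have c2 : det3R (V f₁) y x = 0 := by linarith
  rw [c1, c2, zero_smul, zero_smul, zero_add, zero_add] at hcr
  -- `|coefficient| = |det|`
  have hn := congrArg (fun z => ‖z‖) hcr
  simp only [norm_smul, Real.norm_eq_abs, hxn, hyn] at hn
  have habs : |det3R (V f₁) (V f₂) x| = |det3R (V f₁) (V f₂) y| := by
    have := mul_right_cancel₀ hνpos.ne' hn; exact this
  rcases abs_eq_abs.mp habs with hc | hc
  · -- same sign: `y = x`
    rw [← hc] at hcr
    have hyx : y = x := smul_right_injective _ hD hcr
    -- `V, W` agree on the frame `(f₁, f₂, ν)`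
    have key := linearMap_eq_of_det3R_ne_zero hdetν (L₁ := V.toLinearMap) (L₂ := W.toLinearMap) (by simpa using hV1) (by simpa using hV2)
      (by simpa [hx, hy] using hyx.symm)
    intro v
    have := LinearMap.congr_fun key v
    simpa using this
  · -- opposite sign: `y = −x`, contradicting closeness at `ν`
    exfalso
    rw [show det3R (V f₁) (V f₂) y = -det3R (V f₁) (V f₂) x by linarith, neg_smul, ← smul_neg] at hcr
    have hyx : y = -x := smul_right_injective _ hD hcr
    have h2 : ‖V ν - W ν‖ = 2 * ‖ν‖ := by
      rw [← hx, ← hy, hyx, sub_neg_eq_add, ← two_smul ℝ x, norm_smul, Real.norm_eq_abs, abs_of_pos two_pos, hxn]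
    have := hclose ν
    linarith

/-- A tripod with the determinant exposed (cf. `exists_tripod_of_twoShell`). [this file] -/
theorem exists_frame_of_adjacent {P : Finset (EuclideanSpace ℝ (Fin 3))} (hP : P = fccTwoShellPattern ∨ P = hcpTwoShellPattern)
    {f₁ f₂ : EuclideanSpace ℝ (Fin 3)} (hf₁ : f₁ ∈ P) (h₁ : ‖f₁‖ = 1) (hf₂ : f₂ ∈ P) (h₂ : ‖f₂‖ = 1) (h12 : dist f₁ f₂ = 1) :
    ∃ g : EuclideanSpace ℝ (Fin 3), det3R f₁ f₂ g ≠ 0 := by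
  rcases hP with rfl | rfl
  · have hS : ∀ z ∈ fccInt, sqNormInt z = ((2 : ℕ) : ℤ) := sqNormInt_fccInt
    obtain ⟨g, -, -, -, -, hg⟩ := exists_tripod_scaled two_ne_zero hS mem_fccInt_of_sqNormInt tripodInt_fcc hf₁ h₁ hf₂ h₂ h12
    exact ⟨g, hg⟩
  · have hS : ∀ z ∈ hcpInt, sqNormInt z = ((18 : ℕ) : ℤ) := sqNormInt_hcpInt
    obtain ⟨g, -, -, -, -, hg⟩ := exists_tripod_scaled (by norm_num) hS mem_hcpInt_of_sqNormInt tripodInt_hcp hf₁ h₁ hf₂ h₂ h12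
    exact ⟨g, hg⟩

/-- **D-C · SNAP TRANSPORT BY CLOSENESS**: as `snap_transport`, with the third-site hypothesis `htri` replaced by `1`-closeness of the two
isometries (supplied in DEV by three transfer estimates of `pair_snap`, which give `O(ε)`-closeness). [this file] -/
theorem snap_transport_of_close {Pn : Finset (EuclideanSpace ℝ (Fin 3))} (hPn : Pn = fccTwoShellPattern ∨ Pn = hcpTwoShellPattern)
    (Ucp Upn W : EuclideanSpace ℝ (Fin 3) →ₗᵢ[ℝ] EuclideanSpace ℝ (Fin 3))
    {e_cp e_cn e_pc e_pn f_nc f_np : EuclideanSpace ℝ (Fin 3)}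
    (h1 : e_cn = e_cp + Ucp e_pn) (h2 : Ucp e_pc = -e_cp) (h3 : e_pc = e_pn + Upn f_nc) (h4 : Upn f_np = -e_pn)
    (h5 : W f_nc = -e_cn) (h6 : e_cp = e_cn + W f_np)
    (hfnc : f_nc ∈ Pn) (hfnc1 : ‖f_nc‖ = 1) (hfnp : f_np ∈ Pn) (hfnp1 : ‖f_np‖ = 1) (hadj : dist f_nc f_np = 1)
    (hclose : ∀ v, ‖Ucp (Upn v) - W v‖ ≤ ‖v‖) : ∀ v, Ucp (Upn v) = W v := by
  obtain ⟨g, hg⟩ := exists_frame_of_adjacent hPn hfnc hfnc1 hfnp hfnp1 hadj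
  have a1 : Ucp (Upn f_nc) = W f_nc := by
    have : Upn f_nc = e_pc - e_pn := by rw [h3]; abel
    rw [this, map_sub, h2, h5, h1]; abel
  have a2 : Ucp (Upn f_np) = W f_np := by
    have hW' : W f_np = e_cp - e_cn := by rw [h6]; abel
    rw [h4, map_neg, hW', h1]; abel
  have h12 : ⟪f_nc, f_np⟫ = 1 / 2 := real_inner_eq_half hfnc1 hfnp1 (by rw [← dist_eq_norm]; exact hadj)
  have key := linearIsometry_eq_of_pair_of_close (Ucp.comp Upn) W hfnc1 hfnp1 h12 hg (by simpa using a1) (by simpa using a2)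
    (by simpa using hclose)
  intro v; simpa using key v

/-- **D-C · CLOSENESS FROM THREE TRANSFERS** (the DEV discharge of `hclose` in `snap_transport_of_close`): if the frame `Fc` is bounded
below by `lam`, and the three pair snaps carry the transfer estimates `‖Fc (Ucp v) - Fp v‖ ≤ η₁‖v‖`, `‖Fp (Upn v) - Fn v‖ ≤ η₂‖v‖`,
`‖Fc (W v) - Fn v‖ ≤ η₃‖v‖` with `η₁ + η₂ + η₃ ≤ lam`, then `Ucp ∘ Upn` and `W` are `1`-close. [this file; memo NODE-g59-DevSpec §8] -/
theorem close_of_three_transfers {Fc Fp Fn : EuclideanSpace ℝ (Fin 3) →ₗ[ℝ] EuclideanSpace ℝ (Fin 3)}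
    {Ucp Upn W : EuclideanSpace ℝ (Fin 3) →ₗᵢ[ℝ] EuclideanSpace ℝ (Fin 3)} {lam η₁ η₂ η₃ : ℝ} (hlam : 0 < lam)
    (hlow : ∀ x, lam * ‖x‖ ≤ ‖Fc x‖) (h₁ : ∀ v, ‖Fc (Ucp v) - Fp v‖ ≤ η₁ * ‖v‖) (h₂ : ∀ v, ‖Fp (Upn v) - Fn v‖ ≤ η₂ * ‖v‖)
    (h₃ : ∀ v, ‖Fc (W v) - Fn v‖ ≤ η₃ * ‖v‖) (hsum : η₁ + η₂ + η₃ ≤ lam) : ∀ v, ‖Ucp (Upn v) - W v‖ ≤ ‖v‖ := by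
  intro v
  have hkey : ‖Fc (Ucp (Upn v) - W v)‖ ≤ (η₁ + η₂ + η₃) * ‖v‖ := by
    have hsplit : Fc (Ucp (Upn v) - W v) =
        (Fc (Ucp (Upn v)) - Fp (Upn v)) + (Fp (Upn v) - Fn v) - (Fc (W v) - Fn v) := by
      rw [map_sub]; abel
    rw [hsplit]
    have e1 := h₁ (Upn v)
    rw [LinearIsometry.norm_map] at e1
    have e2 := h₂ v
    have e3 := h₃ v
    calc ‖(Fc (Ucp (Upn v)) - Fp (Upn v)) + (Fp (Upn v) - Fn v) - (Fc (W v) - Fn v)‖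
        ≤ ‖(Fc (Ucp (Upn v)) - Fp (Upn v)) + (Fp (Upn v) - Fn v)‖ + ‖Fc (W v) - Fn v‖ := norm_sub_le _ _
      _ ≤ (‖Fc (Ucp (Upn v)) - Fp (Upn v)‖ + ‖Fp (Upn v) - Fn v‖) + ‖Fc (W v) - Fn v‖ := by
          gcongr; exact norm_add_le _ _
      _ ≤ (η₁ * ‖v‖ + η₂ * ‖v‖) + η₃ * ‖v‖ := by gcongr
      _ = (η₁ + η₂ + η₃) * ‖v‖ := by ring
  have h := (hlow (Ucp (Upn v) - W v)).trans (hkey.trans (mul_le_mul_of_nonneg_right hsum (norm_nonneg v)))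
  exact le_of_mul_le_mul_left h hlam

end Summit.AtomisticToContinuum.Crystallization.Theorems.OverbindingBudgetAffineFarSmoothSplit
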